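import Summits.HubbardSuperconductivity.HubbardSuperconductivity.Theorems.NodalDiracTwistRealCyclicOverlap
import Literature.MathematicalPhysics.QuantumLattice.FockRelabel

/-!
# Route `NodalDiracTwist`, crux `BridgeNodalToDWave` (stmt-HubbardSuperconductivity-10395) —
# helper: translation invariance of the spin-twisted torus and REAL crystal momentum of a unique
# sector ground state

Line `birth`, lead c11 (`--supports stmt-HubbardSuperconductivity-10395`).  The registered stub
`stub_classificationCore` (C) concludes a pair-order floor for the UNIQUE untwisted `(N_L, S^z=0)`
sector ground state `χ` of `hubbardTorus 2 L 1 U` from the nodal-Dirac package of the spin-twisted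
family `H_L(U,φ) = spinTwistedHubbardTorus L U φ`, whose clause (I) asserts that the sector ground
state of `H_L(U,φ)` is unique at every twist of the cell off the diagonal quartet.  This file proves,
with no hypothesis beyond that uniqueness, the first rigorous structural constraints such a ground
state obeys (lead c9's informal audit item S3, now kernel-checked):

* `relabel_translate_spinTwistedHubbardTorus` — **`H_L(U,φ)` is translation invariant** for every
  twist `φ` (the boost gauge spreads the twist uniformly over the bonds): `T_v H_L(U,φ) T_v⁻¹ = H_L(U,φ)`.
* `exists_fockTranslate_mulVec_eq_smul` — a sector ground state of `H_L(U,φ)` that is unique up to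
  scalars is an eigenvector of every lattice translation `U_v = fockTranslate v`.
* `fockTranslate_mulVec_eq_self_or_eq_neg` — **its crystal momentum is REAL**: `U_v χ = χ` or
  `U_v χ = -χ` for every `v ∈ (ℤ/Lℤ)²`, i.e. `K ∈ {0, π}²`.  Mechanism: the antiunitary symmetry
  `T = F ∘ K` of `H_L(U,φ)` (`isGroundStateInSector_spinFlip_star`, route item `RealCyclicOverlap`)
  commutes with the REAL signed-permutation unitaries `U_v` (`star_fockRelabel_mulVec`,
  `spinSwap_mul_translate`), so `U_v χ = z χ` and `T χ = w χ` force `z = conj z`; unitarity gives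
  `|z| = 1`, hence `z = ±1`.
* `hubbardTorus_fockTranslate_mulVec_eq_self_or_eq_neg` — the same for the untwisted torus
  `hubbardTorus 2 L 1 U` (`= H_L(U,0)` for `3 ≤ L`), i.e. for the state `χ` in C's conclusion; and
  `hubbardTorus_fockD4_mulVec_eq_self_or_eq_neg` — that `χ` is also a `±1` eigenvector of every
  point-group operation `U_γ`, `γ ∈ D₄` (it spans a REAL one-dimensional representation
  `A₁, A₂, B₁` or `B₂` of the space group of the square torus).
All three are instances of `fockRelabel_mapEquiv_mulVec_eq_self_or_eq_neg`: a unique `(N, S^z=0)`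
sector ground state of `H_L(U,φ)` is a `±1` eigenvector of `U_g` for EVERY site permutation `g`
that is a symmetry of `H_L(U,φ)`.

Consequences recorded for the line (not formalised here): wherever clause (I) of the package holds,
the ground state lies in ONE momentum block `K(φ) ∈ {0,π}²`, locally constant in `φ`, hence constant
on the connected set `T² ∖ {(±c,±c)}`; at `φ = 0` the `D₄` symmetry further forces `K ∈ {0, (π,π)}`.

Sources: Y. Hatsugai, J. Phys. Soc. Jpn. 75 (2006) 123601 (antiunitary symmetry, `ℤ₂` quantisation);
G. Benfatto, A. Giuliani, V. Mastropietro, Ann. Henri Poincaré 7 (2006) 809, §2.2 (translation and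
lattice symmetries of the Hubbard torus); O. Bratteli, D. W. Robinson, *Operator Algebras and QSM II*
§5.2.2 (second quantisation of one-particle permutations).  No new definitions, no named facts.
-/

-- the mandated namespace `Summit.<Summit>.<Problem>.Theorems` repeats `HubbardSuperconductivity`
set_option linter.dupNamespace false

noncomputable section

namespace Summit.HubbardSuperconductivity.HubbardSuperconductivity.Theorems.NodalDiracTwist.BridgeNodalToDWave

open Matrix Literature.MathematicalPhysics.QuantumLattice Literature.Probability.LatticeModels
open Summit.HubbardSuperconductivity.HubbardSuperconductivity.Theorems.NodalDiracTwist
open scoped ComplexOrder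

/-! ### Generic: the relabelling unitaries are real -/

section Generic

variable {ι : Type*} [LinearOrder ι] [Fintype ι]

/-- **`U_π` is a REAL matrix**: it commutes with entrywise complex conjugation of Fock vectors,
`K (U_π ψ) = U_π (K ψ)` (its entries are the Jordan–Wigner signs `0, ±1`).
Bratteli–Robinson II §5.2.2; Tasaki (2020) §9.2. [folklore] -/
theorem star_fockRelabel_mulVec (π : Equiv.Perm ι) (ψ : Fock ι) :
    star ((fockRelabel π).val *ᵥ ψ) = (fockRelabel π).val *ᵥ star ψ := by
  funext s
  rw [Pi.star_apply, fockRelabel_mulVec_apply, fockRelabel_mulVec_apply, star_mul', star_relabelSign,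
    Pi.star_apply]

end Generic

/-! ### Translations versus unit shifts and the spin exchange -/

section Shifts

variable {d L : ℕ} [NeZero L]

/-- Translations commute with the unit shifts: `(x + v) + e_μ = (x + e_μ) + v` on the fermionic
torus. [folklore] -/
theorem shift_ofTorusEquiv_addRight (v : TorusSite d L) (x : FermionTorus d L) (μ : Fin d) :
    FermionTorus.shift (FermionTorus.ofTorusEquiv (Equiv.addRight v) x) μ =
      FermionTorus.ofTorusEquiv (Equiv.addRight v) (FermionTorus.shift x μ) := by
  apply FermionTorus.toTorusSite_injective
  rw [FermionTorus.toTorusSite_shift, FermionTorus.toTorusSite_ofTorusEquiv,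
    FermionTorus.toTorusSite_ofTorusEquiv, Equiv.coe_addRight, FermionTorus.toTorusSite_shift,
    add_right_comm]

/-- `Orb.translate v (x, σ) = (x + v, σ)` for a site `x` of the fermionic torus. [folklore] -/
theorem translate_orb_fermionTorus (v : TorusSite d L) (x : FermionTorus d L) (σ : Fin 2) :
    Orb.translate v (orb x σ) = orb (FermionTorus.ofTorusEquiv (Equiv.addRight v) x) σ := by
  rw [Orb.translate, Orb.mapEquiv_orb]

/-- The spin exchange `(x,σ) ↦ (x,1-σ)` commutes with every site permutation `(x,σ) ↦ (g x,σ)`.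
[folklore] -/
theorem spinSwap_mul_mapEquiv {Λ : Type*} (g : Equiv.Perm Λ) :
    (Orb.spinSwap : Equiv.Perm (Orb Λ)) * Orb.mapEquiv g = Orb.mapEquiv g * Orb.spinSwap := by
  ext o : 1
  rw [Equiv.Perm.mul_apply, Equiv.Perm.mul_apply]
  change Orb.spinSwap (Orb.mapEquiv g (orb (ofLex o).1 (ofLex o).2)) =
    Orb.mapEquiv g (Orb.spinSwap (orb (ofLex o).1 (ofLex o).2))
  rw [Orb.mapEquiv_orb, Orb.spinSwap_orb, Orb.spinSwap_orb, Orb.mapEquiv_orb]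

/-- The spin exchange commutes with the translations `(x,σ) ↦ (x+v,σ)`. [folklore] -/
theorem spinSwap_mul_translate (v : TorusSite d L) :
    (Orb.spinSwap : Equiv.Perm (Orb (FermionTorus d L))) * Orb.translate v =
      Orb.translate v * Orb.spinSwap :=
  spinSwap_mul_mapEquiv _

end Shifts

/-! ### Translation invariance of the spin-twisted torus -/

section Translation

variable (L : ℕ) [NeZero L]

/-- **The twisted hopping is translation invariant**: in the boost gauge every bond in direction `μ`
carries the same phase `e^{±i(-1)^σ φ_μ/L}`, so `T_v T_L(φ) T_v⁻¹ = T_L(φ)` (reindex `x ↦ x + v`).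
Benfatto–Giuliani–Mastropietro (2006) §2.2; Shastry–Sutherland, PRL 65 (1990) 243. [folklore] -/
theorem relabel_translate_spinTwistedHopping (v : TorusSite 2 L) (φ : Fin 2 → ℝ) :
    relabel (Orb.translate v) (spinTwistedHopping L φ) = spinTwistedHopping L φ := by
  unfold spinTwistedHopping
  rw [relabel_sum]
  refine Fintype.sum_equiv (FermionTorus.ofTorusEquiv (Equiv.addRight v)) _ _ fun x => ?_
  rw [relabel_sum]
  refine Finset.sum_congr rfl fun μ _ => ?_
  rw [relabel_sum]
  refine Finset.sum_congr rfl fun σ _ => ?_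
  rw [relabel_add, relabel_smul, relabel_smul, relabel_mul, relabel_mul, relabel_creation,
    relabel_annihilation, relabel_creation, relabel_annihilation, translate_orb_fermionTorus,
    translate_orb_fermionTorus, ← shift_ofTorusEquiv_addRight]

/-- The on-site interaction `Σ_x n_{x↑} n_{x↓}` is translation invariant. [folklore] -/
theorem relabel_translate_sum_numberOp_mul_numberOp (v : TorusSite 2 L) :
    relabel (Orb.translate v)
        (∑ x : FermionTorus 2 L, (numberOp x 0 * numberOp x 1 :
          Matrix (Finset (Orb (FermionTorus 2 L))) (Finset (Orb (FermionTorus 2 L))) ℂ)) =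
      ∑ x : FermionTorus 2 L, numberOp x 0 * numberOp x 1 := by
  rw [relabel_sum]
  refine Fintype.sum_equiv (FermionTorus.ofTorusEquiv (Equiv.addRight v)) _ _ fun x => ?_
  rw [relabel_mul, numberOp, numberOp, numberOp, numberOp, relabel_mul, relabel_mul, relabel_creation,
    relabel_annihilation, relabel_creation, relabel_annihilation, translate_orb_fermionTorus,
    translate_orb_fermionTorus]

/-- **Translation invariance of the spin-twisted Hubbard torus**: `T_v H_L(U,φ) T_v⁻¹ = H_L(U,φ)`
for every twist `φ` and every `v ∈ (ℤ/Lℤ)²`. Benfatto–Giuliani–Mastropietro (2006) §2.2;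
Karakuzu–Seki–Sorella, PRB 98 (2018) 075156, Sec. II D. [folklore] -/
theorem relabel_translate_spinTwistedHubbardTorus (v : TorusSite 2 L) (U : ℝ) (φ : Fin 2 → ℝ) :
    relabel (Orb.translate v) (spinTwistedHubbardTorus L U φ) = spinTwistedHubbardTorus L U φ := by
  rw [spinTwistedHubbardTorus, relabel_add, relabel_neg, relabel_smul,
    relabel_translate_spinTwistedHopping, relabel_translate_sum_numberOp_mul_numberOp]

/-- `[U_v, H_L(U,φ)] = 0`. [folklore] -/
theorem fockTranslate_commute_spinTwistedHubbardTorus (v : TorusSite 2 L) (U : ℝ) (φ : Fin 2 → ℝ) :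
    Commute (fockTranslate v).val (spinTwistedHubbardTorus L U φ) :=
  fockRelabel_commute_of_relabel_eq _ (relabel_translate_spinTwistedHubbardTorus L v U φ)

/-! ### Unique sector ground states have real crystal momentum -/

/-- **A unique sector ground state is a translation eigenvector.** If `χ` is a ground state of
`H_L(U,φ)` in the sector `(N, S^z = M)` and every such ground state is a multiple of `χ`, then
`U_v χ = z χ` for every translation `v`. [folklore] -/
theorem exists_fockTranslate_mulVec_eq_smul {U : ℝ} {φ : Fin 2 → ℝ} {N : ℕ} {M : ℝ}
    {χ : Fock (Orb (FermionTorus 2 L))}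
    (hχ : IsGroundStateInSector (spinTwistedHubbardTorus L U φ) N M χ)
    (huniq : ∀ χ', IsGroundStateInSector (spinTwistedHubbardTorus L U φ) N M χ' → ∃ z : ℂ, χ' = z • χ)
    (v : TorusSite 2 L) : ∃ z : ℂ, (fockTranslate v).val *ᵥ χ = z • χ :=
  huniq _ (hχ.fockTranslate_mulVec v (relabel_translate_spinTwistedHubbardTorus L v U φ))

/-- **A unique `(N, S^z = 0)` sector ground state is a `±1` eigenvector of every site symmetry.**
If the site permutation `g` is a symmetry of `H_L(U,φ)` (`relabel (Orb.mapEquiv g) H = H`) and the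
sector ground state `χ` of `H_L(U,φ)` is unique up to scalars, then `U_g χ = χ` or `U_g χ = -χ`.
Proof: `U_g χ` is a sector ground state, so `U_g χ = z χ`; the antiunitary symmetry `T = F ∘ K`
(`isGroundStateInSector_spinFlip_star`) gives `T χ = w χ` with `w ≠ 0`; `U_g` is REAL
(`star_fockRelabel_mulVec`) and commutes with the spin exchange `F` (`spinSwap_mul_mapEquiv`), so
applying `T` to `U_g χ = z χ` yields `U_g (Tχ) = conj(z) Tχ`, whence `z = conj z`; `U_g` is unitary,
so `|z| = 1`; hence `z² = 1`. Hatsugai, J. Phys. Soc. Jpn. 75 (2006) 123601 (antiunitary symmetry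
with `T² = 1` ⇒ real structure). [folklore] -/
theorem fockRelabel_mapEquiv_mulVec_eq_self_or_eq_neg {U : ℝ} {φ : Fin 2 → ℝ} {N : ℕ}
    (g : Equiv.Perm (FermionTorus 2 L))
    (hg : relabel (Orb.mapEquiv g) (spinTwistedHubbardTorus L U φ) = spinTwistedHubbardTorus L U φ)
    {χ : Fock (Orb (FermionTorus 2 L))}
    (hχ : IsGroundStateInSector (spinTwistedHubbardTorus L U φ) N 0 χ)
    (huniq : ∀ χ', IsGroundStateInSector (spinTwistedHubbardTorus L U φ) N 0 χ' → ∃ z : ℂ, χ' = z • χ) :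
    (fockRelabel (Orb.mapEquiv g)).val *ᵥ χ = χ ∨ (fockRelabel (Orb.mapEquiv g)).val *ᵥ χ = -χ := by
  obtain ⟨z, hz⟩ := huniq _ (hχ.fockRelabel_mapEquiv_mulVec g hg)
  have hχ0 : χ ≠ 0 := hχ.2.1
  -- the antiunitary partner `T χ = F (K χ)` is a sector ground state, hence `= w • χ`, `w ≠ 0`
  have hT := isGroundStateInSector_spinFlip_star L hχ
  obtain ⟨w, hw⟩ := huniq _ hT
  have hw0 : w ≠ 0 := by
    rintro rfl
    exact hT.2.1 (by rw [hw, zero_smul])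
  -- `F` commutes with `U_g`
  have hFU : (fockRelabel (Orb.spinSwap : Orb (FermionTorus 2 L) ≃ Orb (FermionTorus 2 L))).val *
      (fockRelabel (Orb.mapEquiv g)).val =
      (fockRelabel (Orb.mapEquiv g)).val *
        (fockRelabel (Orb.spinSwap : Orb (FermionTorus 2 L) ≃ Orb (FermionTorus 2 L))).val := by
    have h : fockRelabel (Orb.spinSwap : Orb (FermionTorus 2 L) ≃ Orb (FermionTorus 2 L)) *
        fockRelabel (Orb.mapEquiv g) =
        fockRelabel (Orb.mapEquiv g) *
          fockRelabel (Orb.spinSwap : Orb (FermionTorus 2 L) ≃ Orb (FermionTorus 2 L)) := by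
      rw [← map_mul, spinSwap_mul_mapEquiv, map_mul]
    exact congrArg Subtype.val h
  -- apply `T` to `U_g χ = z χ`: `U_g (T χ) = conj(z) (T χ)`
  have h1 : (fockRelabel (Orb.mapEquiv g)).val *ᵥ
      ((fockRelabel (Orb.spinSwap : Orb (FermionTorus 2 L) ≃ Orb (FermionTorus 2 L))).val *ᵥ
        star χ) =
      star z • ((fockRelabel (Orb.spinSwap : Orb (FermionTorus 2 L) ≃ Orb (FermionTorus 2 L))).val *ᵥ
        star χ) := by
    have h2 := congrArg (fun ψ : Fock (Orb (FermionTorus 2 L)) =>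
      (fockRelabel (Orb.spinSwap : Orb (FermionTorus 2 L) ≃ Orb (FermionTorus 2 L))).val *ᵥ star ψ) hz
    rw [star_fockRelabel_mulVec, star_smul, mulVec_smul, mulVec_mulVec, hFU, ← mulVec_mulVec] at h2
    exact h2
  rw [hw, mulVec_smul, hz, smul_smul, smul_smul] at h1
  -- `(w z) χ = (conj z · w) χ` with `χ ≠ 0`, `w ≠ 0` ⇒ `z = conj z`
  have hreal : z = star z := by
    have h3 : (w * z - star z * w) • χ = 0 := by rw [sub_smul, h1, sub_self]
    have h4 : w * z - star z * w = 0 := by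
      by_contra hne
      exact hχ0 ((smul_eq_zero.1 h3).resolve_left hne)
    have h5 : w * z = w * star z := by rw [mul_comm w (star z)]; exact sub_eq_zero.1 h4
    exact mul_left_cancel₀ hw0 h5
  -- unitarity: `|z|² = 1`
  have hnorm : star z * z = 1 := by
    have h6 := star_fockRelabel_mulVec_dotProduct (Orb.mapEquiv g) χ
    rw [hz, star_smul, smul_dotProduct, dotProduct_smul, smul_smul, smul_eq_mul] at h6
    have hne : star χ ⬝ᵥ χ ≠ 0 := fun h => hχ0 (dotProduct_star_self_eq_zero.1 h)
    exact mul_right_cancel₀ hne (h6.trans (one_mul _).symm)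
  -- hence `z² = 1`
  have hz1 : z = 1 ∨ z = -1 := by
    rw [← hreal] at hnorm
    exact mul_self_eq_one_iff.1 hnorm
  rcases hz1 with rfl | rfl
  · left; rw [hz, one_smul]
  · right; rw [hz, neg_one_smul]

/-- **Registered sub-goal `stub_uniqueGroundStateSymmetrySign` of crux stmt-HubbardSuperconductivity-10395**
(lead c11, line `birth`; structural input to stub C): the statement of
`fockRelabel_mapEquiv_mulVec_eq_self_or_eq_neg` with all binders explicit and all names fully
qualified — a unique `(N, S^z = 0)` sector ground state of `H_L(U,φ)` is a `±1` eigenvector of `U_g`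
for every site symmetry `g` of `H_L(U,φ)`. Hatsugai, J. Phys. Soc. Jpn. 75 (2006) 123601. [folklore] -/
theorem stub_uniqueGroundStateSymmetrySign : ∀ (L : ℕ) [NeZero L] (U : ℝ) (φ : Fin 2 → ℝ) (N : ℕ) (g : Equiv.Perm (Literature.MathematicalPhysics.QuantumLattice.FermionTorus 2 L)), Literature.MathematicalPhysics.QuantumLattice.relabel (Literature.MathematicalPhysics.QuantumLattice.Orb.mapEquiv g) (Literature.MathematicalPhysics.QuantumLattice.spinTwistedHubbardTorus L U φ) = Literature.MathematicalPhysics.QuantumLattice.spinTwistedHubbardTorus L U φ → ∀ χ : Literature.MathematicalPhysics.QuantumLattice.Fock (Literature.MathematicalPhysics.QuantumLattice.Orb (Literature.MathematicalPhysics.QuantumLattice.FermionTorus 2 L)), Literature.MathematicalPhysics.QuantumLattice.IsGroundStateInSector (Literature.MathematicalPhysics.QuantumLattice.spinTwistedHubbardTorus L U φ) N 0 χ → (∀ χ' : Literature.MathematicalPhysics.QuantumLattice.Fock (Literature.MathematicalPhysics.QuantumLattice.Orb (Literature.MathematicalPhysics.QuantumLattice.FermionTorus 2 L)), Literature.MathematicalPhysics.QuantumLattice.IsGroundStateInSector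 (Literature.MathematicalPhysics.QuantumLattice.spinTwistedHubbardTorus L U φ) N 0 χ' → ∃ z : ℂ, χ' = z • χ) → Matrix.mulVec (Literature.MathematicalPhysics.QuantumLattice.fockRelabel (Literature.MathematicalPhysics.QuantumLattice.Orb.mapEquiv g)).val χ = χ ∨ Matrix.mulVec (Literature.MathematicalPhysics.QuantumLattice.fockRelabel (Literature.MathematicalPhysics.QuantumLattice.Orb.mapEquiv g)).val χ = -χ :=
  fun L _ _ _ _ g hg _ hχ huniq => fockRelabel_mapEquiv_mulVec_eq_self_or_eq_neg L g hg hχ huniq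

/-- **Real crystal momentum of a unique `(N, S^z = 0)` sector ground state of the spin-twisted
torus**: if the sector ground state `χ` of `H_L(U,φ)` is unique up to scalars, then for every
translation `v`, `U_v χ = χ` or `U_v χ = -χ` (momentum `K ∈ {0,π}²`), at ANY twist `φ`.
Hatsugai, J. Phys. Soc. Jpn. 75 (2006) 123601; Benfatto–Giuliani–Mastropietro (2006) §2.2. [folklore] -/
theorem fockTranslate_mulVec_eq_self_or_eq_neg {U : ℝ} {φ : Fin 2 → ℝ} {N : ℕ}
    {χ : Fock (Orb (FermionTorus 2 L))}
    (hχ : IsGroundStateInSector (spinTwistedHubbardTorus L U φ) N 0 χ)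
    (huniq : ∀ χ', IsGroundStateInSector (spinTwistedHubbardTorus L U φ) N 0 χ' → ∃ z : ℂ, χ' = z • χ)
    (v : TorusSite 2 L) :
    (fockTranslate v).val *ᵥ χ = χ ∨ (fockTranslate v).val *ᵥ χ = -χ :=
  fockRelabel_mapEquiv_mulVec_eq_self_or_eq_neg L _ (relabel_translate_spinTwistedHubbardTorus L v U φ)
    hχ huniq

/-- **Real crystal momentum of the unique untwisted sector ground state** (the state `χ` in the
conclusion of stub C): for `3 ≤ L`, if the `(N, S^z = 0)` sector ground state `χ` of
`hubbardTorus 2 L 1 U` is unique up to scalars then `U_v χ = ± χ` for every translation `v`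
(`hubbardTorus 2 L 1 U = H_L(U,0)`, `spinTwistedHubbardTorus_zero`). Hatsugai (2006);
Benfatto–Giuliani–Mastropietro (2006) §2.2. [folklore] -/
theorem hubbardTorus_fockTranslate_mulVec_eq_self_or_eq_neg (hL : 3 ≤ L) {U : ℝ} {N : ℕ}
    {χ : Fock (Orb (FermionTorus 2 L))}
    (hχ : IsGroundStateInSector (hubbardTorus 2 L 1 U) N 0 χ)
    (huniq : ∀ χ', IsGroundStateInSector (hubbardTorus 2 L 1 U) N 0 χ' → ∃ z : ℂ, χ' = z • χ)
    (v : TorusSite 2 L) :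
    (fockTranslate v).val *ᵥ χ = χ ∨ (fockTranslate v).val *ᵥ χ = -χ := by
  rw [← spinTwistedHubbardTorus_zero L hL U] at hχ huniq
  exact fockTranslate_mulVec_eq_self_or_eq_neg L hχ huniq v

/-- **The unique untwisted sector ground state spans a real one-dimensional representation of the
point group**: for `3 ≤ L`, if the `(N, S^z = 0)` sector ground state `χ` of `hubbardTorus 2 L 1 U`
is unique up to scalars then `U_γ χ = ± χ` for every `γ ∈ D₄` (`fockD4`; with the translations this
places `χ` in a momentum `K ∈ {0,π}²` fixed by `D₄`, i.e. `K ∈ {0, (π,π)}`, and in one of the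
channels `A₁, A₂, B₁, B₂`). Scalapino, Phys. Rep. 250 (1995) 329, §2 (the point group `C₄ᵥ ≅ D₄`);
Hatsugai (2006). [folklore] -/
theorem hubbardTorus_fockD4_mulVec_eq_self_or_eq_neg (hL : 3 ≤ L) {U : ℝ} {N : ℕ}
    {χ : Fock (Orb (FermionTorus 2 L))}
    (hχ : IsGroundStateInSector (hubbardTorus 2 L 1 U) N 0 χ)
    (huniq : ∀ χ', IsGroundStateInSector (hubbardTorus 2 L 1 U) N 0 χ' → ∃ z : ℂ, χ' = z • χ)
    (γ : DihedralGroup 4) :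
    (fockD4 (L := L) γ).val *ᵥ χ = χ ∨ (fockD4 (L := L) γ).val *ᵥ χ = -χ := by
  have hg : relabel (Orb.mapEquiv (FermionTorus.ofTorusEquiv (d4SitePerm γ)))
      (spinTwistedHubbardTorus L U 0) = spinTwistedHubbardTorus L U 0 := by
    rw [← Orb.d4Perm_eq_mapEquiv, spinTwistedHubbardTorus_zero L hL U]
    exact relabel_d4Perm_hubbardTorus γ 1 U
  rw [← spinTwistedHubbardTorus_zero L hL U] at hχ huniq
  exact fockRelabel_mapEquiv_mulVec_eq_self_or_eq_neg L _ hg hχ huniq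

end Translation

end Summit.HubbardSuperconductivity.HubbardSuperconductivity.Theorems.NodalDiracTwist.BridgeNodalToDWave

end
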